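import Summits.BirchSwinnertonDyer.BirchSwinnertonDyer.Theorems.ResidualThetaTransportAtTwoThetaLayerLambdaCongruenceAtTwoDepletion
import Summits.BirchSwinnertonDyer.BirchSwinnertonDyer.Theorems.ResidualThetaTransportAtTwoThetaLayerLambdaCongruenceAtTwoMuDictionary
import Literature.NumberTheory.EllipticCurves.QuadraticTwistRamifiedLocalPolynomialProofs
import HarnessLib

/-!
# Crux `ThetaLayerLambdaCongruenceAtTwo` (stmt-BirchSwinnertonDyer-20688, route ResidualThetaTransportAtTwo), line
# `birth`: BOTH `S₀`-depleted layer elements of the crux ARE `C 2 ·` the layer sums of the `S₀`-DEPLETED PLUS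
# SYMBOLS — exact form of the depletion identity (width prover bsd-wall-rtt-p3-w2 g0;
# `--supports stmt-BirchSwinnertonDyer-20688 --as helper`; closes nothing)

HONEST FRAMING. THEOREMS of the tree's definitions only; nothing about any curve or form is asserted; BSD is not proved
by any of this.

WHAT. Companion of `…ThetaLayerLambdaCongruenceAtTwoDepletion.lean` (the depletion identity modulo
`ω_n = (1+X)^{2ⁿ} − 1` for an arbitrary even `1`-periodic function and arbitrary Euler polynomials of bounded degree at
odd moduli). Here it is specialised to the PARTNER side of the crux: `ψ = ι ∘ [·]⁺_{g,Ω}` (even and `1`-periodic: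
`plusSymbolK_neg`, `plusSymbolK_add_intCast`), Euler polynomials `1 − ι a_{ℓ_v}(g) X + 𝟙_{ℓ_v∤M} ℓ_v X²` at the places
`v ∈ S₀` (all odd since `2 ∉ v`), and the `Δ`-doubled element `θ_n(g;Ω)^ι = C 2·ϑ_n(ψ)` (`mazurTateElementK_two`).
Since a single-count layer sum has degree `< 2ⁿ = deg ω_n`, the reduction is the identity on it, and the crux's term
becomes, EXACTLY,

  `Θ^{S₀}_n(g;Ω) = C 2 · ∑_{s mod 2ⁿ} φ^{S₀}_{g,Ω}(γ^s/2^{n+2}) (1+X)^s`,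
  `φ^{S₀}_{g,Ω}(x) = ∑_{k : S₀ → {0,1,2}} (∏_v c_{v,k_v} ℓ_v^{−k_v}) · ι[x · ∏_v ℓ_v^{k_v}]⁺_{g,Ω}`

(`c_{v,0} = 1`, `c_{v,1} = −ι a_{ℓ_v}(g)`, `c_{v,2} = 𝟙_{ℓ_v∤M} ℓ_v`: the depletion operator
`∏_v (1 − ι a_ℓ ℓ⁻¹[ℓ] + 𝟙_{ℓ∤M} ℓ⁻¹[ℓ²])` applied to the plus symbol; Greenberg–Vatsal §1 (8) at the layers), and the
same on the CURVE side: `Θ^{S₀}_n(W) = C 2 · ∑_s φ^{S₀}_W(γ^s/2^{n+2})(1+X)^s` with `φ_W = [·]⁺_f` (`ratPlusSymbol f`,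
even and `1`-periodic: `ratPlusSymbol_neg`, `ratPlusSymbol_add_intCast_eq`; doubling `mazurTateElement_two`) and the
Euler polynomials `L_v(W, X) ∈ ℤ[X]` (degree `≤ 2`, `natDegree_localPolynomial_le_two`). Hence the
two research stubs of skeleton v4 of line `birth` — (H♮) `‖C a·Θ_W − Θ_g‖_sup < ‖2‖₂`, (μ♮) `‖Θ_g‖_sup = ‖2‖₂` — are
statements about the VALUES `φ^{S₀}_{g,Ω}(γ^s/2^{n+2})` of the depleted plus symbol (through the group-ring isometry
`‖∑ c_s (1+X)^s‖_sup = max_s ‖c_s‖`, sibling seat rtt-p3-w3): this is where multiplicity one mod `2` enters.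

References: [GreenbergVatsal2000] §1 p. 9 (display (8)); [PollackWeston2011MT] §2.1 (2.1), §2.2;
[MazurTateTeitelbaum1986Invent] §I.13.
-/

noncomputable section

-- justification: the `Summit.BirchSwinnertonDyer.BirchSwinnertonDyer.…` path repeats a component (route-file convention)
set_option linter.dupNamespace false

open scoped Classical

open Polynomial

open Literature.NumberTheory.IwasawaTheory Literature.NumberTheory.EllipticCurves
  Literature.NumberTheory.EllipticCurves.ModularForms

namespace Summit.BirchSwinnertonDyer.BirchSwinnertonDyer.Theorems.ThetaLayerLambdaCongruenceAtTwo

/-! ## The partner's depleted layer element of the crux IS the layer sum of the depleted plus symbol -/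

section Partner

variable {K : Type*} [Field K]

/-- A single-count layer sum has degree `< 2ⁿ` (each `(1+X)^s`, `s < 2ⁿ`). [folklore] -/
theorem natDegree_layerSum_lt (c : ℕ → K) (n : ℕ) :
    (∑ s : ZMod (2 ^ n), C (c s.val) * (X + 1 : K[X]) ^ s.val).natDegree < 2 ^ n := by
  have hpos : 0 < 2 ^ n := pow_pos two_pos n
  refine lt_of_le_of_lt (Polynomial.natDegree_sum_le_of_forall_le _ _ fun s _ ↦ ?_) (Nat.sub_lt hpos one_pos)
  refine (natDegree_C_mul_le _ _).trans ?_
  have h1 : (X + 1 : K[X]).natDegree ≤ 1 := by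
    rw [← C_1]; exact (natDegree_add_le _ _).trans (max_le natDegree_X_le (by rw [natDegree_C]; exact zero_le_one))
  refine (natDegree_pow_le_of_le _ h1).trans ?_
  rw [mul_one]
  exact Nat.le_sub_one_of_lt (ZMod.val_lt s)

/-- Hence reduction modulo `ω_n = (1+X)^{2ⁿ} − 1` leaves a single-count layer sum unchanged. [folklore] -/
theorem layerSum_modByMonic_layerModulus (c : ℕ → K) (n : ℕ) :
    (∑ s : ZMod (2 ^ n), C (c s.val) * (X + 1 : K[X]) ^ s.val) %ₘ ((X + 1) ^ 2 ^ n - 1) =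
      ∑ s : ZMod (2 ^ n), C (c s.val) * (X + 1 : K[X]) ^ s.val := by
  have hmonic : ((X + 1 : K[X]) ^ 2 ^ n - 1).Monic := by
    have hX : (X + 1 : K[X]) = X + C 1 := by rw [C_1]
    have h1 : ((X + 1 : K[X]) ^ 2 ^ n).Monic := by rw [hX]; exact (monic_X_add_C 1).pow _
    apply h1.sub_of_left
    rw [degree_one, degree_eq_natDegree h1.ne_zero, hX, natDegree_pow, natDegree_X_add_C, mul_one]
    exact_mod_cast pow_pos two_pos n
  refine (modByMonic_eq_self_iff hmonic).mpr (degree_lt_degree ?_)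
  have hdeg : ((X + 1 : K[X]) ^ 2 ^ n - 1).natDegree = 2 ^ n := by
    have hX : (X + 1 : K[X]) = X + C 1 := by rw [C_1]
    rw [hX, natDegree_sub_eq_left_of_natDegree_lt] <;>
      rw [natDegree_pow, natDegree_X_add_C, mul_one]
    rw [natDegree_one]; exact pow_pos two_pos n
  rw [hdeg]
  exact natDegree_layerSum_lt c n

/-- The partner's Euler polynomial `1 − ι a_ℓ(g)·X + 𝟙_{ℓ∤M} ℓ·X²` has degree `≤ 2`. [folklore] -/
theorem natDegree_partnerEulerPolynomial_le (b : K) (M ℓ : ℕ) :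
    (1 - C b * X + (if ℓ ∣ M then 0 else C (ℓ : K)) * X ^ 2 : K[X]).natDegree ≤ 2 := by
  refine (natDegree_add_le _ _).trans (max_le ((natDegree_sub_le _ _).trans (max_le ?_ ?_)) ?_)
  · rw [natDegree_one]; exact Nat.zero_le _
  · exact (natDegree_C_mul_le _ _).trans (natDegree_X_le.trans one_le_two)
  · split_ifs
    · rw [zero_mul, natDegree_zero]; exact Nat.zero_le _
    · exact (natDegree_C_mul_le _ _).trans (by rw [natDegree_X_pow])

variable {N : ℕ} [NeZero N] (g : CuspForm (CongruenceSubgroup.Gamma0 N) 2) (Ω : ℂ)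

/-- **The partner's `S₀`-depleted layer element of the crux is EXACTLY `C 2 ·` the layer sum of the `S₀`-DEPLETED plus
symbol.** For a newform datum `(g, Ω, ι)` and a finite set `S₀` of places off `2`, at every layer `n`:

  `Θ^{S₀}_n(g;Ω) := (θ_n(g;Ω)^ι · ∏_{v∈S₀} (1 − ι a_{ℓ_v} X + 𝟙_{ℓ_v∤M} ℓ_v X²) ∘ (ℓ_v⁻¹(1+X)^{e_v})) mod ω_n
     = C 2 · ∑_{s mod 2ⁿ} φ^{S₀}_{g,Ω}(γ^s/2^{n+2}) (1+X)^s`,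

with the depleted plus symbol `φ^{S₀}_{g,Ω}(x) = ∑_{k : S₀ → {0,1,2}} (∏_v c_{v,k_v} ℓ_v^{−k_v}) · ι[x·∏_v ℓ_v^{k_v}]⁺_{g,Ω}`,
`c_{v,·}` the coefficients of the Euler polynomial at `v` (i.e. `φ^{S₀} = ∏_v (1 − ι a_ℓ ℓ⁻¹[ℓ] + 𝟙_{ℓ∤M} ℓ⁻¹[ℓ²]) φ`).
In particular the stubs (H♮)/(μ♮) of line `birth` are statements about the VALUES of the depleted plus symbols at the
layer-`n` sample points. [cite: GreenbergVatsal2000, §1 p. 9 (display (8))] -/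
theorem depletedPartnerLayer_eq_layerSum_depletedSymbol (ι : coeffField g →+* PadicAlgCl 2) (n M : ℕ)
    (S₀ : Finset (IsDedekindDomain.HeightOneSpectrum (NumberField.RingOfIntegers ℚ)))
    (hS2 : ∀ v ∈ S₀, ((2 : ℕ) : NumberField.RingOfIntegers ℚ) ∉ v.asIdeal) :
    ((mazurTateElementK g Ω 2 n).map ι * ∏ v ∈ S₀, (1 - C (embCoeff g ι (Rat.HeightOneSpectrum.natGenerator v)) * X + (if Rat.HeightOneSpectrum.natGenerator v ∣ M then 0 else C (Rat.HeightOneSpectrum.natGenerator v : PadicAlgCl 2)) * X ^ 2).comp (C ((Rat.HeightOneSpectrum.natGenerator v : PadicAlgCl 2)⁻¹) * (X + 1) ^ (PadicInt.toZModPow n (-(GreenbergVatsal2000.frobeniusExponent 2 (Rat.HeightOneSpectrum.natGenerator v : ℤ_[2])))).val)) %ₘ ((X + 1) ^ 2 ^ n - 1) =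
      C (2 : PadicAlgCl 2) * ∑ s : ZMod (2 ^ n), C ((∑ k ∈ Fintype.piFinset (fun _ : S₀ ↦ Finset.range 3),
          (∏ v : S₀, (1 - C (embCoeff g ι (Rat.HeightOneSpectrum.natGenerator (v : IsDedekindDomain.HeightOneSpectrum (NumberField.RingOfIntegers ℚ)))) * X + (if Rat.HeightOneSpectrum.natGenerator (v : IsDedekindDomain.HeightOneSpectrum (NumberField.RingOfIntegers ℚ)) ∣ M then 0 else C (Rat.HeightOneSpectrum.natGenerator (v : IsDedekindDomain.HeightOneSpectrum (NumberField.RingOfIntegers ℚ)) : PadicAlgCl 2)) * X ^ 2 : (PadicAlgCl 2)[X]).coeff (k v) *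
              ((Rat.HeightOneSpectrum.natGenerator (v : IsDedekindDomain.HeightOneSpectrum (NumberField.RingOfIntegers ℚ)) : PadicAlgCl 2)⁻¹) ^ (k v)) *
            ι (plusSymbolK g Ω (((((cyclotomicGenerator 2 : ZMod (2 ^ (n + 2))) ^ s.val).val : ℚ) /
              (2 : ℚ) ^ (n + 2)) * ((∏ v : S₀, Rat.HeightOneSpectrum.natGenerator (v : IsDedekindDomain.HeightOneSpectrum (NumberField.RingOfIntegers ℚ)) ^ (k v) : ℕ) : ℚ))))) *
          (X + 1) ^ s.val := by
  have hmonic : ((X + 1 : (PadicAlgCl 2)[X]) ^ 2 ^ n - 1).Monic := by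
    have hX : (X + 1 : (PadicAlgCl 2)[X]) = X + C 1 := by rw [C_1]
    have h1 : ((X + 1 : (PadicAlgCl 2)[X]) ^ 2 ^ n).Monic := by rw [hX]; exact (monic_X_add_C 1).pow _
    apply h1.sub_of_left
    rw [degree_one, degree_eq_natDegree h1.ne_zero, hX, natDegree_pow, natDegree_X_add_C, mul_one]
    exact_mod_cast pow_pos two_pos n
  -- the plus symbol along `ι` is even and `1`-periodic
  have hneg : ∀ x : ℚ, ι (plusSymbolK g Ω (-x)) = ι (plusSymbolK g Ω x) := fun x ↦ by rw [plusSymbolK_neg]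
  have hper : ∀ (x : ℚ) (k : ℤ), ι (plusSymbolK g Ω (x + k)) = ι (plusSymbolK g Ω x) := fun x k ↦ by
    rw [plusSymbolK_add_intCast]
  have hodd : ∀ v ∈ S₀, ¬ 2 ∣ Rat.HeightOneSpectrum.natGenerator v := fun v hv ↦ not_two_dvd_natGenerator (hS2 v hv)
  have h := layerSum_mul_prod_eulerFactor_congr (fun x ↦ ι (plusSymbolK g Ω x)) hneg hper S₀
    (fun v ↦ Rat.HeightOneSpectrum.natGenerator v) hodd
    (fun v ↦ (1 - C (embCoeff g ι (Rat.HeightOneSpectrum.natGenerator v)) * X +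
      (if Rat.HeightOneSpectrum.natGenerator v ∣ M then 0 else C (Rat.HeightOneSpectrum.natGenerator v : PadicAlgCl 2)) *
        X ^ 2 : (PadicAlgCl 2)[X]))
    (d := 2) (fun v _ ↦ natDegree_partnerEulerPolynomial_le _ _ _) n
  rw [map_mazurTateElementK_two, mul_assoc, C_mul', smul_modByMonic, modByMonic_eq_of_dvd_sub hmonic h]
  have hfix := layerSum_modByMonic_layerModulus (K := PadicAlgCl 2)
    (fun t ↦ ∑ k ∈ Fintype.piFinset (fun _ : S₀ ↦ Finset.range (2 + 1)),
      (∏ v : S₀, (1 - C (embCoeff g ι (Rat.HeightOneSpectrum.natGenerator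
          (v : IsDedekindDomain.HeightOneSpectrum (NumberField.RingOfIntegers ℚ)))) * X +
          (if Rat.HeightOneSpectrum.natGenerator (v : IsDedekindDomain.HeightOneSpectrum (NumberField.RingOfIntegers ℚ)) ∣ M
            then 0 else C (Rat.HeightOneSpectrum.natGenerator
              (v : IsDedekindDomain.HeightOneSpectrum (NumberField.RingOfIntegers ℚ)) : PadicAlgCl 2)) *
            X ^ 2 : (PadicAlgCl 2)[X]).coeff (k v) *
        ((Rat.HeightOneSpectrum.natGenerator
          (v : IsDedekindDomain.HeightOneSpectrum (NumberField.RingOfIntegers ℚ)) : PadicAlgCl 2)⁻¹) ^ (k v)) *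
      ι (plusSymbolK g Ω (((((cyclotomicGenerator 2 : ZMod (2 ^ (n + 2))) ^ t).val : ℚ) / (2 : ℚ) ^ (n + 2)) *
        ((∏ v : S₀, Rat.HeightOneSpectrum.natGenerator
          (v : IsDedekindDomain.HeightOneSpectrum (NumberField.RingOfIntegers ℚ)) ^ (k v) : ℕ) : ℚ)))) n
  beta_reduce at hfix
  rw [hfix, ← C_mul']

end Partner

/-! ## The curve's depleted layer element of the crux IS the layer sum of its depleted plus symbol -/

section Curve

variable {N : ℕ} [NeZero N] (f : CuspForm (CongruenceSubgroup.Gamma0 N) 2)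

/-- The `ξ = −1` summand equals the `ξ = 1` summand on the curve side: `[(−x).val/2^{n+2}]⁺_f = [x.val/2^{n+2}]⁺_f`
for `x = γ^s` (periodicity `ratPlusSymbol_add_intCast_eq` and evenness `ratPlusSymbol_neg`).
[cite: MazurTateTeitelbaum1986Invent, §I.8 and §I.13] -/
theorem ratPlusSymbol_neg_val_div (n s : ℕ) :
    ratPlusSymbol f (((-((cyclotomicGenerator 2 : ZMod (2 ^ (n + 2))) ^ s)).val : ℚ) / (2 : ℚ) ^ (n + 2)) =
      ratPlusSymbol f ((((cyclotomicGenerator 2 : ZMod (2 ^ (n + 2))) ^ s).val : ℚ) / (2 : ℚ) ^ (n + 2)) := by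
  haveI : Fact (1 < 2 ^ (n + 2)) := ⟨Nat.one_lt_two_pow (by omega)⟩
  set x : ZMod (2 ^ (n + 2)) := (cyclotomicGenerator 2 : ZMod (2 ^ (n + 2))) ^ s with hx
  have hunit : IsUnit x := by
    rw [hx]
    refine IsUnit.pow _ ?_
    rw [ZMod.isUnit_iff_coprime, cyclotomicGenerator_two]
    exact Nat.Coprime.pow_right _ (by norm_num)
  have hx0 : x ≠ 0 := hunit.ne_zero
  have hval : (-x).val = 2 ^ (n + 2) - x.val := by rw [ZMod.neg_val, if_neg hx0]
  have hlt : x.val ≤ 2 ^ (n + 2) := (ZMod.val_lt x).le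
  have hcast : (((-x).val : ℕ) : ℚ) = (2 : ℚ) ^ (n + 2) - (x.val : ℚ) := by
    rw [hval, Nat.cast_sub hlt]; push_cast; ring
  have e : (((-x).val : ℕ) : ℚ) / (2 : ℚ) ^ (n + 2) = -((x.val : ℚ) / (2 : ℚ) ^ (n + 2)) + ((1 : ℤ) : ℚ) := by
    rw [hcast]; push_cast; field_simp; ring
  rw [e, ratPlusSymbol_add_intCast_eq, ratPlusSymbol_neg]

/-- **The `Δ`-doubling on the curve side**: `θ_n(f) = mazurTateElement f 2 n = C 2 · ∑_{s mod 2ⁿ} [γ^s/2^{n+2}]⁺_f (1+X)^s`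
(rational plus symbol; the same argument as `mazurTateElementK_two`). [cite: MazurTateTeitelbaum1986Invent, §I.13 (p = 2: Δ = {±1}, γ = 5)] -/
theorem mazurTateElement_two (n : ℕ) :
    mazurTateElement f 2 n =
      C (2 : ℚ) * ∑ s : ZMod (2 ^ n),
        C (ratPlusSymbol f ((((cyclotomicGenerator 2 : ZMod (2 ^ (n + 2))) ^ s.val).val : ℚ) /
          (2 : ℚ) ^ (n + 2))) * (X + 1) ^ s.val := by
  classical
  set G : ℤ_[2] → ℚ[X] := fun u ↦ ∑ s : ZMod (2 ^ n),
    C (ratPlusSymbol f (((PadicInt.toZModPow (n + 2) u *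
        (cyclotomicGenerator 2 : ZMod (2 ^ (n + 2))) ^ s.val).val : ℚ) / (2 : ℚ) ^ (n + 2))) *
      (X + 1) ^ s.val with hG
  have hG1 : G 1 = ∑ s : ZMod (2 ^ n),
      C (ratPlusSymbol f ((((cyclotomicGenerator 2 : ZMod (2 ^ (n + 2))) ^ s.val).val : ℚ) /
        (2 : ℚ) ^ (n + 2))) * (X + 1) ^ s.val := by
    simp only [hG, map_one, one_mul]
  have hGneg : G (-1) = G 1 := by
    simp only [hG, map_neg, map_one, neg_one_mul, one_mul, ratPlusSymbol_neg_val_div]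
  have hζmem : (-1 : ℤ_[2]ˣ) ∈ rootsOfUnity 2 ℤ_[2] := by
    rw [mem_rootsOfUnity]; norm_num
  set ζ : rootsOfUnity 2 ℤ_[2] := ⟨-1, hζmem⟩ with hζ
  have hne : (1 : rootsOfUnity 2 ℤ_[2]) ≠ ζ := by
    intro h
    have h' : (((1 : rootsOfUnity 2 ℤ_[2]) : ℤ_[2]ˣ) : ℤ_[2]) = ((ζ : ℤ_[2]ˣ) : ℤ_[2]) := by
      rw [h]
    rw [hζ] at h'
    simp only [OneMemClass.coe_one, Units.val_one, Units.val_neg] at h'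
    have h2 : (2 : ℤ_[2]) = 0 := by linear_combination h'
    exact two_ne_zero h2
  haveI : Fintype (rootsOfUnity 2 ℤ_[2]) := Fintype.ofFinite _
  have hroots : ∀ ξ : rootsOfUnity 2 ℤ_[2], ((ξ : ℤ_[2]ˣ) : ℤ_[2]) = 1 ∨ ((ξ : ℤ_[2]ˣ) : ℤ_[2]) = -1 := by
    intro ξ
    have h := ξ.2
    rw [mem_rootsOfUnity] at h
    have h' : (((ξ : ℤ_[2]ˣ) : ℤ_[2])) ^ 2 = 1 := by
      rw [← Units.val_pow_eq_pow_val, h, Units.val_one]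
    exact sq_eq_one_iff.mp h'
  have huniv : (Finset.univ : Finset (rootsOfUnity 2 ℤ_[2])) = {1, ζ} := by
    ext ξ
    simp only [Finset.mem_univ, Finset.mem_insert, Finset.mem_singleton, true_iff]
    rcases hroots ξ with h | h
    · left
      exact Subtype.ext (Units.ext (by simpa using h))
    · right
      exact Subtype.ext (Units.ext (by rw [hζ]; simpa using h))
  have hRS : mazurTateElement f 2 n = ∑ᶠ ξ : rootsOfUnity (torsionOrder 2) ℤ_[2], G ((ξ : ℤ_[2]ˣ) : ℤ_[2]) := by
    rw [mazurTateElement]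
    rfl
  rw [hRS, torsionOrder_two, finsum_eq_sum_of_fintype, huniv, Finset.sum_pair hne]
  simp only [OneMemClass.coe_one, Units.val_one, hζ, Units.val_neg]
  rw [hGneg, hG1, ← two_mul, ← map_ofNat C 2]

/-- `θ_n(f)` read in `ℚ̄₂[X]` is `C 2 ·` the single-count layer sum of `[·]⁺_f` (the doubling, mapped).
[cite: MazurTateTeitelbaum1986Invent, §I.13 (p = 2: Δ = {±1}, γ = 5)] -/
theorem map_mazurTateElement_two {K : Type*} [Field K] [CharZero K] (n : ℕ) :
    (mazurTateElement f 2 n).map (algebraMap ℚ K) =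
      C (2 : K) * ∑ s : ZMod (2 ^ n), C (algebraMap ℚ K (ratPlusSymbol f
        ((((cyclotomicGenerator 2 : ZMod (2 ^ (n + 2))) ^ s.val).val : ℚ) / (2 : ℚ) ^ (n + 2)))) *
          (X + 1) ^ s.val := by
  rw [mazurTateElement_two, Polynomial.map_mul, Polynomial.map_C, map_ofNat, Polynomial.map_sum]
  refine congrArg _ (Finset.sum_congr rfl fun s _ ↦ ?_)
  rw [Polynomial.map_mul, Polynomial.map_C, Polynomial.map_pow, Polynomial.map_add, Polynomial.map_X,
    Polynomial.map_one]

/-- **The curve's `S₀`-depleted layer element of the crux is EXACTLY `C 2 ·` the layer sum of the `S₀`-DEPLETED rational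
plus symbol.** For a cusp form `f` on `Γ₀(N)`, a curve `W/ℚ` (supplying the Euler polynomials `L_v(W, X) ∈ ℤ[X]`), a
finite set `S₀` of places off `2` and every layer `n`:

  `Θ^{S₀}_n(W) := (θ_n(f) · ∏_{v∈S₀} L_v(W,X) ∘ (ℓ_v⁻¹(1+X)^{e_v})) mod ω_n = C 2 · ∑_{s mod 2ⁿ} φ^{S₀}_W(γ^s/2^{n+2}) (1+X)^s`,
  `φ^{S₀}_W(x) = ∑_{k : S₀ → {0,1,2}} (∏_v coeff_{k_v}(L_v(W,X)) ℓ_v^{−k_v}) · [x·∏_v ℓ_v^{k_v}]⁺_f`.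
[cite: GreenbergVatsal2000, §1 p. 9 (display (8))] -/
theorem depletedCurveLayer_eq_layerSum_depletedSymbol (W : WeierstrassCurve ℚ) (n : ℕ)
    (S₀ : Finset (IsDedekindDomain.HeightOneSpectrum (NumberField.RingOfIntegers ℚ)))
    (hS2 : ∀ v ∈ S₀, ((2 : ℕ) : NumberField.RingOfIntegers ℚ) ∉ v.asIdeal) :
    ((mazurTateElement f 2 n).map (algebraMap ℚ (PadicAlgCl 2)) * ∏ v ∈ S₀, ((W.localPolynomialAt v).map (Int.castRingHom (PadicAlgCl 2))).comp (C ((Rat.HeightOneSpectrum.natGenerator v : PadicAlgCl 2)⁻¹) * (X + 1) ^ (PadicInt.toZModPow n (-(GreenbergVatsal2000.frobeniusExponent 2 (Rat.HeightOneSpectrum.natGenerator v : ℤ_[2])))).val)) %ₘ ((X + 1) ^ 2 ^ n - 1) =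
      C (2 : PadicAlgCl 2) * ∑ s : ZMod (2 ^ n), C ((∑ k ∈ Fintype.piFinset (fun _ : S₀ ↦ Finset.range 3),
          (∏ v : S₀, ((W.localPolynomialAt (v : IsDedekindDomain.HeightOneSpectrum (NumberField.RingOfIntegers ℚ))).map (Int.castRingHom (PadicAlgCl 2))).coeff (k v) *
              ((Rat.HeightOneSpectrum.natGenerator (v : IsDedekindDomain.HeightOneSpectrum (NumberField.RingOfIntegers ℚ)) : PadicAlgCl 2)⁻¹) ^ (k v)) *
            algebraMap ℚ (PadicAlgCl 2) (ratPlusSymbol f (((((cyclotomicGenerator 2 : ZMod (2 ^ (n + 2))) ^ s.val).val : ℚ) /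
              (2 : ℚ) ^ (n + 2)) * ((∏ v : S₀, Rat.HeightOneSpectrum.natGenerator (v : IsDedekindDomain.HeightOneSpectrum (NumberField.RingOfIntegers ℚ)) ^ (k v) : ℕ) : ℚ))))) *
          (X + 1) ^ s.val := by
  have hmonic : ((X + 1 : (PadicAlgCl 2)[X]) ^ 2 ^ n - 1).Monic := by
    have hX : (X + 1 : (PadicAlgCl 2)[X]) = X + C 1 := by rw [C_1]
    have h1 : ((X + 1 : (PadicAlgCl 2)[X]) ^ 2 ^ n).Monic := by rw [hX]; exact (monic_X_add_C 1).pow _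
    apply h1.sub_of_left
    rw [degree_one, degree_eq_natDegree h1.ne_zero, hX, natDegree_pow, natDegree_X_add_C, mul_one]
    exact_mod_cast pow_pos two_pos n
  have hneg : ∀ x : ℚ, algebraMap ℚ (PadicAlgCl 2) (ratPlusSymbol f (-x)) = algebraMap ℚ (PadicAlgCl 2) (ratPlusSymbol f x) :=
    fun x ↦ by rw [ratPlusSymbol_neg]
  have hper : ∀ (x : ℚ) (k : ℤ), algebraMap ℚ (PadicAlgCl 2) (ratPlusSymbol f (x + k)) =
      algebraMap ℚ (PadicAlgCl 2) (ratPlusSymbol f x) := fun x k ↦ by rw [ratPlusSymbol_add_intCast_eq]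
  have hodd : ∀ v ∈ S₀, ¬ 2 ∣ Rat.HeightOneSpectrum.natGenerator v := fun v hv ↦ not_two_dvd_natGenerator (hS2 v hv)
  have h := layerSum_mul_prod_eulerFactor_congr (fun x ↦ algebraMap ℚ (PadicAlgCl 2) (ratPlusSymbol f x)) hneg hper S₀
    (fun v ↦ Rat.HeightOneSpectrum.natGenerator v) hodd
    (fun v ↦ (W.localPolynomialAt v).map (Int.castRingHom (PadicAlgCl 2)))
    (d := 2) (fun v _ ↦ (natDegree_map_le).trans (WeierstrassCurve.natDegree_localPolynomial_le_two _)) n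
  rw [map_mazurTateElement_two, mul_assoc, C_mul', smul_modByMonic, modByMonic_eq_of_dvd_sub hmonic h]
  have hfix := layerSum_modByMonic_layerModulus (K := PadicAlgCl 2)
    (fun t ↦ ∑ k ∈ Fintype.piFinset (fun _ : S₀ ↦ Finset.range (2 + 1)),
      (∏ v : S₀, ((W.localPolynomialAt (v : IsDedekindDomain.HeightOneSpectrum (NumberField.RingOfIntegers ℚ))).map
          (Int.castRingHom (PadicAlgCl 2))).coeff (k v) *
        ((Rat.HeightOneSpectrum.natGenerator
          (v : IsDedekindDomain.HeightOneSpectrum (NumberField.RingOfIntegers ℚ)) : PadicAlgCl 2)⁻¹) ^ (k v)) *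
      algebraMap ℚ (PadicAlgCl 2) (ratPlusSymbol f
        (((((cyclotomicGenerator 2 : ZMod (2 ^ (n + 2))) ^ t).val : ℚ) / (2 : ℚ) ^ (n + 2)) *
        ((∏ v : S₀, Rat.HeightOneSpectrum.natGenerator
          (v : IsDedekindDomain.HeightOneSpectrum (NumberField.RingOfIntegers ℚ)) ^ (k v) : ℕ) : ℚ)))) n
  beta_reduce at hfix
  rw [hfix, ← C_mul']

end Curve


end Summit.BirchSwinnertonDyer.BirchSwinnertonDyer.Theorems.ThetaLayerLambdaCongruenceAtTwo

end
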